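import Literature.MathematicalPhysics.QuantumFieldTheory.ConstructiveQFTWave0OddRPProofs
import Literature.MathematicalPhysics.QuantumFieldTheory.LatticeGaugeStaticPotentialProofs
import Literature.MathematicalPhysics.QuantumFieldTheory.LatticeGaugeProofs

/-! Convention checks for STUB 1 of line sup-axis-reflection-transfer (drefute seat). -/

open Literature.MathematicalPhysics.QuantumFieldTheory

variable {G : Type} [Group G] [MeasurableSpace G] {S : ℕ}

/-- `Φ := torusConfigShift v ∘ configPerm π` evaluates through the stub's label `ℓ e`. -/
example (π : Equiv.Perm (Fin 4)) (v : Site 4 (2 * S + 1)) (U : GaugeConfig 4 (2 * S + 1) G)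
    (e : Edge 4 (2 * S + 1)) :
    torusConfigShift v (configPerm π U) e = U (sitePerm π.symm (e.1 - v), π.symm e.2) := by
  simp

/-- `Φ⁻¹ := configPerm π⁻¹ ∘ torusConfigShift (-v)` is a left inverse of `Φ`. -/
example (π : Equiv.Perm (Fin 4)) (v : Site 4 (2 * S + 1)) (U : GaugeConfig 4 (2 * S + 1) G) :
    configPerm π.symm (torusConfigShift (-v) (torusConfigShift v (configPerm π U))) = U := by
  funext e
  simp only [configPerm_apply, torusConfigShift_apply, Equiv.symm_symm, sub_neg_eq_add,
    add_sub_cancel_right]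
  have h1 : sitePerm π.symm (sitePerm π e.1) = e.1 := by ext j; simp
  rw [h1, Equiv.symm_apply_apply]

/-- … and a right inverse. -/
example (π : Equiv.Perm (Fin 4)) (v : Site 4 (2 * S + 1)) (U : GaugeConfig 4 (2 * S + 1) G) :
    torusConfigShift v (configPerm π (configPerm π.symm (torusConfigShift (-v) U))) = U := by
  funext e
  simp only [configPerm_apply, torusConfigShift_apply, Equiv.symm_symm, sub_neg_eq_add]
  have h1 : sitePerm π (sitePerm π.symm (e.1 - v)) + v = e.1 := by
    ext j; simp
  rw [h1, Equiv.apply_symm_apply]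

/-- If `F` depends only on the edges whose label lies in the tree half-space, then `F ∘ Φ` depends only on the
tree half-space `oPosEdges ∪ oSharedEdges` — the hypothesis shape of `wilsonExpectation_oddReflectionPositive`. -/
example (π : Equiv.Perm (Fin 4)) (v : Site 4 (2 * S + 1)) (F : GaugeConfig 4 (2 * S + 1) G → ℝ)
    (hF : DependsOn F {e : Edge 4 (2 * S + 1) |
        WilsonOddRP.IsOPosEdge (sitePerm π.symm (e.1 - v), π.symm e.2) ∨
          WilsonOddRP.IsOSharedEdge (sitePerm π.symm (e.1 - v), π.symm e.2)}) :
    DependsOn (fun U => F (torusConfigShift v (configPerm π U)))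
      ((WilsonOddRP.oPosEdges ∪ WilsonOddRP.oSharedEdges : Finset (Edge 4 (2 * S + 1))) :
        Set (Edge 4 (2 * S + 1))) := by
  intro U V hUV
  apply hF
  intro e he
  simp only [torusConfigShift_apply, configPerm_apply]
  apply hUV
  simp only [Finset.coe_union, Set.mem_union, Finset.mem_coe, WilsonOddRP.mem_oPosEdges,
    WilsonOddRP.mem_oSharedEdges]
  exact he

/-- The transported reflection acts on SITES as the reflection of coordinate `μ = π 0` through `v_μ + ½`
(spatial-edge case): `(Θ U) e = U (e', e.2)` with `e' μ = 2 v_μ + 1 - e.1 μ` and `e' ν = e.1 ν` otherwise. -/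
example (π : Equiv.Perm (Fin 4)) (v : Site 4 (2 * S + 1)) (U : GaugeConfig 4 (2 * S + 1) G)
    (e : Edge 4 (2 * S + 1)) (he : e.2 ≠ π 0) :
    torusConfigShift v (configPerm π (GaugeConfig.timeReflect
      (configPerm π.symm (torusConfigShift (-v) U)))) e =
      U (Function.update e.1 (π 0) (2 * v (π 0) + 1 - e.1 (π 0)), e.2) := by
  have hne : π.symm e.2 ≠ 0 := by
    intro h; apply he; rw [← h]; simp
  simp only [torusConfigShift_apply, configPerm_apply, GaugeConfig.timeReflect, hne, if_false,
    sub_neg_eq_add, Equiv.symm_symm, Equiv.apply_symm_apply]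
  have h1 : sitePerm π (Site.timeReflect (sitePerm π.symm (e.1 - v))) + v =
      Function.update e.1 (π 0) (2 * v (π 0) + 1 - e.1 (π 0)) := by
    ext j
    simp only [sitePerm_apply, Equiv.symm_symm, Pi.add_apply, Site.timeReflect, Function.update_apply,
      Pi.sub_apply]
    by_cases hj : j = π 0
    · subst hj
      simp
      ring
    · have : π.symm j ≠ 0 := by
        intro h; apply hj; rw [← h]; simp
      simp [this, hj]
  rw [h1]
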